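import Literature.NumberTheory.EllipticCurves.CasselsTateLevelAssembly
import Literature.NumberTheory.EllipticCurves.BSDSelmerProofs
import HarnessLib

/-!
# Route `CMKolyvaginAtInertTwo`, crux `CMKolyvaginExactAtInertTwo` (stmt-BirchSwinnertonDyer-24277):
# the ABSTRACT `ℚ`-SIDE of the path-(β) T2 assembly — `ι : Sel_{2^{2L}} → Ш[2^L]` is ONTO (Kummer exactness),
# and the rank-zero member's inputs from an injective `ι` and a nondegenerate pairing on `Ш[2^L]`

Seat `bsd-line-cmk2-p1` g17 (cell `bsd-print-cf2`); helper (`--supports stmt-BirchSwinnertonDyer-24277`).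
THEOREMS ONLY: no definition, no named fact, no `sorry`; no item is closed; BSD is not proved by this.

The assembly `card_mul_card_le_two_pow_two_mul_of_pairData(_canonical/_cmInert)` (this seat) displays, on the
abstract side: `ι₁` surjective; `2^L · Sel(E^{(d_K)}) = 0`; nondegeneracy of `CT₂ ∘ (ι₂ × ι₂)` on `Sel(E^{(d_K)})`
(besides `ker ι₁ = ℤx₁`, `ord x₁ = exp Sel(E)`, nondegeneracy of `CT₁` on `Ш(E)[2^L]`). Here, for ANY elliptic
curve over a number field and any `ι : Sel_{2^{2L}} → Ш[2^L]` compatible with `H¹(K, E[2^{2L}]) → H¹(K, E)`: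

* `selmerToSha_surjective` — `ι` is ONTO: `Ш[2^L] ⊆ Ш ∩ H¹(K,E)[2^{2L}] = image of Sel_{2^{2L}}`
  (`map_torsionH1ToH1_selmerGroup_holds`, Silverman X.4.2 (a));
* `two_pow_smul_eq_zero_of_selmerToSha_injective` — if `ι` is injective then `2^L · Sel_{2^{2L}} = 0`;
* `nondegenerate_pullback_of_selmerToSha_bijective` — if `ι` is injective and `B` is nondegenerate on `Ш[2^L]`
  then `B ∘ (ι × ι)` is nondegenerate on `Sel_{2^{2L}}`.

(On the rank-zero member with no `2`-torsion and `L ≥` the exponent of `Ш[2^∞]`, `ι₂` is injective; that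
arithmetic input stays with the supplier.) References: [SilvermanAEC2009] X.4.2 (a); [MilneADT2006] I §6 Prop. 6.9.
-/

-- single-conjunct summit: `Summit.BirchSwinnertonDyer.BirchSwinnertonDyer.…` repeats the name by design
set_option linter.dupNamespace false
set_option autoImplicit false

noncomputable section

open scoped Classical
open scoped AddSubgroup

universe u

namespace Summit.BirchSwinnertonDyer.BirchSwinnertonDyer.Theorems.KolyvaginPairDataTwo

open WeierstrassCurve NumberField Field
open Literature.NumberTheory.EllipticCurves Literature.NumberTheory.GaloisRepresentations

variable {K : Type u} [Field K] [NumberField K] (W : WeierstrassCurve K) {L : ℕ}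

/-- **`ι : Sel_{2^{2L}}(E/K) → Ш(E/K)[2^L]` is surjective** for every `ι` lifting `H¹(K, E[2^{2L}]) → H¹(K, E)`:
an element of `Ш[2^L]` is killed by `2^{2L}`, hence is the image of a `2^{2L}`-Selmer class (Kummer exactness).
[cite: SilvermanAEC2009, Thm. X.4.2 (a)] -/
theorem selmerToSha_surjective
    (ι : selmerGroup W ((2 ^ (L + L) : ℕ) : ℤ) →+ (W.sha)[(2 ^ L : ℕ)])
    (hι : ∀ z, shaTorsionVal W (2 ^ L) (ι z) = torsionH1ToH1 W ((2 ^ (L + L) : ℕ) : ℤ) z) :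
    Function.Surjective ι := by
  intro a
  have hn : ((2 ^ (L + L) : ℕ) : ℤ) ≠ 0 := by positivity
  -- `a ∈ Ш ∩ H¹(K, E)[2^{2L}]`
  have h2 : shaTorsionVal W (2 ^ L) a ∈ (W.galH1)[((2 ^ (L + L) : ℕ) : ℤ)] := by
    rw [AddSubgroup.torsionBy.nsmul_iff, pow_add, mul_nsmul]
    have h0 : (2 ^ L) • shaTorsionVal W (2 ^ L) a = 0 := by
      rw [← natCast_zsmul]
      exact zsmul_shaTorsionVal W (2 ^ L) a
    rw [h0, nsmul_zero]
  have ha : shaTorsionVal W (2 ^ L) a ∈ W.sha ⊓ (W.galH1)[((2 ^ (L + L) : ℕ) : ℤ)] :=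
    AddSubgroup.mem_inf.mpr ⟨shaTorsionVal_mem W (2 ^ L) a, h2⟩
  rw [← Literature.NumberTheory.EllipticCurves.map_torsionH1ToH1_selmerGroup_holds W hn, AddSubgroup.mem_map] at ha
  obtain ⟨z, hz, hza⟩ := ha
  refine ⟨⟨z, hz⟩, ?_⟩
  apply Subtype.ext
  apply Subtype.ext
  change shaTorsionVal W (2 ^ L) (ι ⟨z, hz⟩) = shaTorsionVal W (2 ^ L) a
  rw [hι]
  exact hza

/-- **If `ι` is injective then `2^L · Sel_{2^{2L}}(E/K) = 0`** (`Ш[2^L]` is killed by `2^L`).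
[cite: MilneADT2006, Ch. I §6 Prop. 6.9] -/
theorem two_pow_smul_eq_zero_of_selmerToSha_injective
    (ι : selmerGroup W ((2 ^ (L + L) : ℕ) : ℤ) →+ (W.sha)[(2 ^ L : ℕ)]) (hinj : Function.Injective ι) :
    ∀ v : selmerGroup W ((2 ^ (L + L) : ℕ) : ℤ), 2 ^ L • v = 0 := by
  intro v
  apply hinj
  rw [map_nsmul, map_zero]
  exact AddSubgroup.torsionBy.nsmul (ι v)

/-- **If `ι` is bijective and `B` is nondegenerate on `Ш[2^L]`, then `B ∘ (ι × ι)` is nondegenerate on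
`Sel_{2^{2L}}`.** [cite: MilneADT2006, Ch. I §6 Prop. 6.9, Thm. 6.13 (a)] -/
theorem nondegenerate_pullback_of_selmerToSha_bijective {R : Type*} [AddCommGroup R]
    (ι : selmerGroup W ((2 ^ (L + L) : ℕ) : ℤ) →+ (W.sha)[(2 ^ L : ℕ)]) (hinj : Function.Injective ι)
    (hsurj : Function.Surjective ι) (B : (W.sha)[(2 ^ L : ℕ)] →+ (W.sha)[(2 ^ L : ℕ)] →+ R)
    (hBnd : ∀ a, (∀ b, B a b = 0) → a = 0) :
    ∀ v : selmerGroup W ((2 ^ (L + L) : ℕ) : ℤ), (∀ w, B (ι v) (ι w) = 0) → v = 0 := by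
  intro v hv
  apply hinj
  rw [map_zero]
  refine hBnd (ι v) fun b ↦ ?_
  obtain ⟨w, rfl⟩ := hsurj b
  exact hv w

end Summit.BirchSwinnertonDyer.BirchSwinnertonDyer.Theorems.KolyvaginPairDataTwo

end
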